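import Literature.NumberTheory.EllipticCurves.KubertTateNineJInvariant
import HarnessLib

/-!
# Kubert's `ℤ/9` family `E₉(f)`: bad reduction at the primes of `num(f)·den(f)·(num(f) − den(f))`, and the
# prime `3` (`v₃(j) = 1` on the additive fibre, the pole of `j` lies at a prime `q ≠ 3` there)

Topic `NumberTheory/EllipticCurves`; companion of `KubertTateNineJInvariant` (at every prime
`q ∣ num·den·(num - den)`: `v_q(j(W)) = -9·v_q(num·den·(num - den))`, `‖j(W)‖_q > 1`, for `C • W = E₉(f)`) and of
`KubertTateNineValuationsThree` / `KubertTateNineLocalDataThree` (the prime `3`). THEOREMS ONLY (no definition,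
no named fact, no `sorry`).

## What is here (all unconditional)

* §1 the general lemma **good reduction at `p` ⟹ `‖j(E)‖_p ≤ 1`** (`norm_j_le_one_of_hasGoodReductionAtPrime`,
  companion of the tree's `one_lt_norm_j_of_hasMultiplicativeReductionAtPrime`; Silverman *AEC* VII.5.1: the
  `ℤ_p`-minimal model has integral `c₄` and unit `Δ`), its contrapositive, and: **`E₉(f)` (any model `W`,
  `C • W = E₉ f`) does NOT have good reduction at any prime of `num·den·(num - den)`**
  (`not_hasGoodReductionAtPrime_of_smul_eq_kubertTate_nine_of_dvd`). With «a curve with a point of order `9` is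
  not additive at any `ℓ ≠ 3`» (Barrios–Roy §3.5 Case 3; in the tree a Summits-side theorem from the torsion
  injection) the reduction there is multiplicative.
* §2 the prime `3`: on the additive fibre `3 ∣ num + den` one has `3 ∤ num·den·(num - den)` (so the bad prime of
  §1 is `≠ 3`) and **`v₃(j(W)) = 1`** (`= 3·2 - 5` from `KubertTateNineValuationsThree`: type `IV` with `3 ‖ j`);
  off the fibre `3 ∣ num·den·(num - den)`, so the companion file applies at `q = 3` (type `I₉ₑ`).

References: [Kubert1976] Table 3; [BarriosRoy2022LocalData] Thm. 3.8 (table, row `C₉`) and §3.5 Case 3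
(arXiv:2104.10337 pp. 18–20); [SilvermanAEC2009] Prop. VII.5.1, Prop. VII.5.5.
-/

noncomputable section

open scoped Classical

namespace WeierstrassCurve


/-! ### §1 Good reduction forces `‖j‖ ≤ 1`; so `E₉(f)` is bad at every prime of `num·den·(num - den)` -/

section GoodReduction

open IsDedekindDomain

variable {W : WeierstrassCurve ℚ} {p : ℕ} [Fact p.Prime]

variable (W) in
/-- **Good reduction at `p` forces `‖j(E)‖_p ≤ 1`**: the `ℤ_p`-minimal model `E'` of `E/ℚ_p` has integral `c₄`
and `v(Δ(E')) = 0` (Mathlib's `WeierstrassCurve.HasGoodReduction`), and `j(E) = j(E') = c₄(E')³/Δ(E')`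
(companion of the tree's `one_lt_norm_j_of_hasMultiplicativeReductionAtPrime`). [cite: SilvermanAEC2009, Prop. VII.5.1(a) and Prop. VII.5.5] -/
theorem norm_j_le_one_of_hasGoodReductionAtPrime [W.IsElliptic] (h : W.HasGoodReductionAtPrime p) :
    ‖(W.j : ℚ_[p])‖ ≤ 1 := by
  set W' : WeierstrassCurve ℚ_[p] := W.baseChange ℚ_[p] with hW'
  set Wm : WeierstrassCurve ℚ_[p] := W'.minimal ℤ_[p] with hWm
  have hgood : Wm.HasGoodReduction ℤ_[p] := h
  haveI : IsMinimal ℤ_[p] Wm := hgood.toIsMinimal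
  obtain ⟨rc, hrc⟩ : ∃ r : ℤ_[p], (r : ℚ_[p]) = Wm.c₄ := ⟨_, integralModel_c₄_eq ℤ_[p] Wm⟩
  obtain ⟨rΔ, hrΔ⟩ : ∃ r : ℤ_[p], (r : ℚ_[p]) = Wm.Δ := ⟨_, integralModel_Δ_eq ℤ_[p] Wm⟩
  have hΔ1 := hgood.goodReduction
  rw [← hrΔ, ← PadicInt.algebraMap_apply, HeightOneSpectrum.valuation_eq_one_iff_notMem] at hΔ1
  change rΔ ∉ IsLocalRing.maximalIdeal ℤ_[p] at hΔ1
  rw [IsLocalRing.mem_maximalIdeal, PadicInt.mem_nonunits] at hΔ1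
  have hΔ1' : ‖rΔ‖ = 1 := le_antisymm (PadicInt.norm_le_one _) (not_lt.mp hΔ1)
  have hΔ0 : W.Δ ≠ 0 := W.isUnit_Δ.ne_zero
  have hj : (W.j : ℚ_[p]) = Wm.c₄ ^ 3 / Wm.Δ := by
    have h1 : W.j = W.c₄ ^ 3 / W.Δ := by
      rw [j, ← coe_Δ', Units.val_inv_eq_inv_val]; ring
    rw [hWm, WeierstrassCurve.minimal, variableChange_c₄, variableChange_Δ, hW', h1]
    simp only [baseChange, map_c₄, map_Δ, eq_ratCast]
    set u : ℚ_[p]ˣ := ((W.baseChange ℚ_[p]).exists_isMinimal ℤ_[p]).choose.u⁻¹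
    have hΔ0' : (algebraMap ℚ ℚ_[p]) W.Δ ≠ 0 := by simpa using hΔ0
    have hu : (u : ℚ_[p]) ≠ 0 := u.ne_zero
    push_cast
    field_simp
  rw [hj, ← hrc, ← hrΔ, norm_div, norm_pow, ← PadicInt.norm_def, ← PadicInt.norm_def, hΔ1', div_one]
  exact pow_le_one₀ (norm_nonneg _) (PadicInt.norm_le_one _)

variable (W) in
/-- Contrapositive: **`‖j(E)‖_p > 1 ⟹ E` does not have good reduction at `p`** (it is potentially multiplicative
there, *AEC* VII.5.5). [cite: SilvermanAEC2009, Prop. VII.5.1 and Prop. VII.5.5] -/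
theorem not_hasGoodReductionAtPrime_of_one_lt_norm_j [W.IsElliptic] (h : 1 < ‖(W.j : ℚ_[p])‖) :
    ¬ W.HasGoodReductionAtPrime p := fun hg =>
  absurd (norm_j_le_one_of_hasGoodReductionAtPrime W hg) (not_le.mpr h)

/-- **`E₉(f)` (any model `W`, `C • W = E₉ f`) has bad reduction at every prime of `num·den·(num - den)`.**
With Barrios–Roy's «additive iff `p = 3` and `3 ∣ a + b`» (in the tree: a curve with a point of order `9` is not
additive at any `ℓ ≠ 3`, seat files) the reduction there is multiplicative.
[cite: BarriosRoy2022LocalData, §3.5 Case 3] [cite: SilvermanAEC2009, Prop. VII.5.1] -/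
theorem not_hasGoodReductionAtPrime_of_smul_eq_kubertTate_nine_of_dvd [W.IsElliptic] {f : ℚ}
    {C : VariableChange ℚ} (hC : C • W = kubertTate (f ^ 2 * (f - 1) * (f ^ 2 - f + 1)) (f ^ 2 * (f - 1)))
    (h : (p : ℤ) ∣ f.num * f.den * (f.num - f.den)) : ¬ W.HasGoodReductionAtPrime p :=
  not_hasGoodReductionAtPrime_of_one_lt_norm_j W (one_lt_norm_j_of_smul_eq_kubertTate_nine_of_dvd hC h)

end GoodReduction

/-! ### §2 The prime `3`: the additive fibre misses `num·den·(num - den)`, and `v₃(j) = 1` there -/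

section Three

variable {W : WeierstrassCurve ℚ} [W.IsElliptic] {f : ℚ} {C : VariableChange ℚ}

/-- On the additive fibre `3 ∣ num + den` (coprime `num, den`): `3 ∤ num·den·(num - den)` — so the primes of
the companion file are all `≠ 3` there. [cite: BarriosRoy2022LocalData, Thm. 3.8 (table, T = C₉, p = 3)] -/
theorem not_three_dvd_num_mul_den_mul_sub_of_three_dvd_add (f : ℚ) (h3 : (3 : ℤ) ∣ f.num + f.den) :
    ¬ ((3 : ℕ) : ℤ) ∣ f.num * f.den * (f.num - f.den) := by
  have hcop : IsCoprime f.num (f.den : ℤ) := by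
    rw [Int.isCoprime_iff_gcd_eq_one]
    exact f.reduced
  -- `3 ∤ den` (coprimality), hence `3 ∤ num` and `3 ∤ num - den` on the fibre
  have hden : ¬ (3 : ℤ) ∣ (f.den : ℤ) := fun hd => by
    have hn : (3 : ℤ) ∣ f.num := by simpa using dvd_sub h3 hd
    have hu := hcop.isUnit_of_dvd' hn hd
    rw [Int.isUnit_iff] at hu
    omega
  have hnum : ¬ (3 : ℤ) ∣ f.num := fun hn => hden (by simpa using dvd_sub h3 hn)
  have hsub : ¬ (3 : ℤ) ∣ f.num - f.den := fun hs => by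
    apply hnum
    have h2 : (3 : ℤ) ∣ 2 * f.num := by
      have e : f.num + ↑f.den + (f.num - ↑f.den) = 2 * f.num := by ring
      simpa [e] using dvd_add h3 hs
    exact (Int.prime_three.dvd_or_dvd h2).resolve_left (by norm_num)
  intro h
  have h' : (3 : ℤ) ∣ f.num * f.den * (f.num - f.den) := by exact_mod_cast h
  rcases Int.prime_three.dvd_or_dvd h' with h1 | h1
  · rcases Int.prime_three.dvd_or_dvd h1 with h2 | h2
    · exact hnum h2
    · exact hden h2
  · exact hsub h1

/-- Conversely, off the fibre (`3 ∤ num + den`): `3 ∣ num·den·(num - den)` (the residues of a coprime pair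
`(num, den) mod 3` with `num + den ≢ 0` have `num ≡ 0`, `den ≡ 0` or `num ≡ den`), so the companion file applies at `q = 3`:
`v₃(j) = -9·v₃(num·den·(num - den)) ≤ -9` (type `I₉ₑ`). [cite: BarriosRoy2022LocalData, Thm. 3.8 (table, T = C₉, p = 3)] -/
theorem three_dvd_num_mul_den_mul_sub_of_not_three_dvd_add (f : ℚ) (h3 : ¬ (3 : ℤ) ∣ f.num + f.den) :
    ((3 : ℕ) : ℤ) ∣ f.num * f.den * (f.num - f.den) := by
  have key : ∀ m n : ℤ, ¬ (3 : ℤ) ∣ m + n → (3 : ℤ) ∣ m * n * (m - n) := by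
    intro m n hmn
    rw [Int.dvd_iff_emod_eq_zero] at hmn ⊢
    have hm : m % 3 = 0 ∨ m % 3 = 1 ∨ m % 3 = 2 := by omega
    have hn : n % 3 = 0 ∨ n % 3 = 1 ∨ n % 3 = 2 := by omega
    rw [Int.add_emod] at hmn
    rw [Int.mul_emod, Int.mul_emod m n, Int.sub_emod]
    rcases hm with hm | hm | hm <;> rcases hn with hn | hn | hn <;> simp [hm, hn] at hmn ⊢
  exact_mod_cast key f.num f.den h3

/-- **On the additive fibre `3 ∣ num + den`: `v₃(j(W)) = 1`** for `C • W = E₉(f)` (`3·v₃(c₄) - v₃(Δ) = 3·2 - 5`;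
type `IV` with `3 ‖ j`). [cite: BarriosRoy2022LocalData, Thm. 3.8 (table, T = C₉, p = 3) and §3.5 Case 3] -/
theorem padicValRat_three_j_of_smul_eq_kubertTate_nine_of_three_dvd_add [Fact (Nat.Prime 3)]
    (hC : C • W = kubertTate (f ^ 2 * (f - 1) * (f ^ 2 - f + 1)) (f ^ 2 * (f - 1)))
    (h3 : (3 : ℤ) ∣ f.num + f.den) : padicValRat 3 W.j = 1 := by
  have hΔ : (kubertTate (f ^ 2 * (f - 1) * (f ^ 2 - f + 1)) (f ^ 2 * (f - 1))).Δ ≠ 0 := by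
    rw [← hC]; exact (C • W).isUnit_Δ.ne_zero
  rw [j_eq_of_smul_eq_kubertTate_nine hC, padicValRat.div (pow_ne_zero _ (kubertTate_nine_c₄_ne_zero f)) hΔ,
    padicValRat.pow, padicValRat_kubertTate_nine_c₄_of_three_dvd f h3,
    padicValRat_kubertTate_nine_Δ_of_three_dvd f h3]
  norm_num

/-- **On the additive fibre the pole of `j` sits at a prime `q ≠ 3`**: `C • W = E₉(f)`, `3 ∣ num + den` ⟹
`∃ q ≠ 3` prime with `v_q(j(W)) ≤ -9`, `‖j(W)‖_q > 1`, and `W` not of good reduction at `q`.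
[cite: BarriosRoy2022LocalData, §3.5 Case 3] [cite: SilvermanAEC2009, Prop. VII.5.5] -/
theorem exists_prime_ne_three_one_lt_norm_j_of_smul_eq_kubertTate_nine_of_three_dvd_add
    (hC : C • W = kubertTate (f ^ 2 * (f - 1) * (f ^ 2 - f + 1)) (f ^ 2 * (f - 1)))
    (h3 : (3 : ℤ) ∣ f.num + f.den) :
    ∃ (q : ℕ) (_ : Fact q.Prime), q ≠ 3 ∧ padicValRat q W.j ≤ -9 ∧ 1 < ‖(W.j : ℚ_[q])‖ ∧
      ¬ W.HasGoodReductionAtPrime q := by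
  obtain ⟨q, hq, hqd, hv, hn⟩ := exists_prime_one_lt_norm_j_of_smul_eq_kubertTate_nine hC
  refine ⟨q, hq, ?_, hv, hn, not_hasGoodReductionAtPrime_of_one_lt_norm_j W hn⟩
  rintro rfl
  exact not_three_dvd_num_mul_den_mul_sub_of_three_dvd_add f h3 hqd

end Three

end WeierstrassCurve

end
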